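import Summits.QuantumFields.YangMills.Theorems.ColdStartUniversalityLatticeLangevinLiebRobinsonCouplingPointwise
import Summits.QuantumFields.YangMills.Theorems.ColdStartUniversalityLatticeLangevinLiebRobinsonCouplingLipschitz
import Summits.QuantumFields.YangMills.Theorems.ColdStartUniversalityLatticeLangevinLiebRobinsonCorrelationLightConeWilsonLoops
import HarnessLib

/-!
# Route `ColdStartUniversality` (fixed-cut-off SZZ dynamics; LIEB–ROBINSON / LOCALITY package, file 42):
# ★★★ UNIFORM-IN-TIME CONTINUITY IN THE COUPLING of the cold-start expectation of a Wilson loop (`|β'| < 1/12`, every volume)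

Helper file (seat `ym-line-csu-p1`, g32; `--supports stmt-QuantumFields-24809`).  Crossover of the coupling light cone (file 41,
`transition_sub_transition_abs_le_coupling`: `≤ C|β₁−β₂|·t·e^(λt)`, every coupling, growing in `t`) with the every-start mixing of BOTH dynamics
(g30 `wilson_word_pointwise_mixing_uniform`, transient decayed by `cube_add_two_mul_exp_neg_le`) and the static coupling-Lipschitz bound of g31
(`wilson_loop_expectation_lipschitz`), for `|β₁|, |β₂| ≤ |β₀| < 1/12`:
* ★★★ `wilson_loop_transition_sub_transition_abs_le_coupling_uniform` — for a nonempty loop word `w`, every start `x`, EVERY `t ≥ 0` and every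
  crossover parameter `τ ≥ 0`:
  `|κ¹_t(Re tr w)(x) − κ²_t(Re tr w)(x)| ≤ 13824π|β₁−β₂|·τ·e^(λ₀τ)·2π|w|² + 24√2π|w|²·(27(1+6(λ₀+ρ₀)/ρ₀)³+2)·e^(−ρ₀τ/2) + C_stat(β₀,|w|)·|β₁−β₂|`,
  `λ₀ = (1300+4√2)|β₀|`, `ρ₀ = 1 − 12|β₀|` — a bound with NO time dependence and NO volume factor; `τ ≈ log(1/|β₁−β₂|)/(λ₀+ρ₀/2)` makes it a
  Hölder modulus `|β₁−β₂|^(ρ₀/(2λ₀+ρ₀))` (not spelled out: no `rpow` here).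
THEOREMS ONLY, no definition, no sorry; [folklore].  HONEST FRAMING: fixed cut-off, fixed strong-coupling window (left by the route's scaling
`β'_K = (γε_K)⁻¹/2 → ∞`); nothing `K`-uniform; `UniformColdStartMixing` (24809) is NOT restated; no crux, rung or summit statement is proved; the
Yang–Mills mass gap is NOT proved.
-/

set_option autoImplicit false

noncomputable section

namespace Summit.QuantumFields.YangMills.Theorems.ColdStartUniversality.LiebRobinson

open MeasureTheory ProbabilityTheory Matrix Complex Finset Filter Set Metric
open scoped ComplexConjugate BigOperators Matrix NNReal ENNReal Topology
open Literature.Probability.Process Literature.MathematicalPhysics.QuantumFieldTheory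
open Literature.MathematicalPhysics.QuantumFieldTheory.Balaban1983to89
open Literature.MathematicalPhysics.QuantumLattice (fundamentalRep fundamentalLatticeRep continuous_fundamentalRep fundamentalRep_apply)

variable {L : ℕ} [NeZero L]

/-! ## Uniformly in time at strong coupling: light cone before the crossover, mixing + static Lipschitz after it -/

/-- ★★★ **Uniform-in-time continuity in the coupling of the cold-start expectation of a Wilson loop** (`|β₁|, |β₂| ≤ |β₀| < 1/12`, every volume,
every start, EVERY time).  For a nonempty loop word `w`, kernel families `κ¹, κ²` realising the SZZ dynamics at `β₁, β₂`, every `t ≥ 0` and every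
crossover parameter `τ ≥ 0`:
`|κ¹_t(Re tr w)(x) − κ²_t(Re tr w)(x)| ≤ 13824π|β₁−β₂|·τ·e^(λ₀τ)·2π|w|² + 24√2π|w|²·(27(1+6(λ₀+ρ₀)/ρ₀)³+2)·e^(−ρ₀τ/2) + C_stat(β₀,|w|)·|β₁−β₂|`,
`λ₀ = (1300+4√2)|β₀|`, `ρ₀ = 1 − 12|β₀|`, `C_stat` the static coupling-Lipschitz constant of g31 (`wilson_loop_expectation_lipschitz`): for `t ≤ τ` the
coupling light cone (file 41), for `t ≥ τ` the every-start mixing of both dynamics (g30 `wilson_word_pointwise_mixing_uniform`, transient decayed by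
`cube_add_two_mul_exp_neg_le`) plus the static Lipschitz bound.  Choosing `τ ≈ log(1/|β₁−β₂|)/(λ₀+ρ₀/2)` gives a HÖLDER modulus
`|β₁−β₂|^(ρ₀/(2λ₀+ρ₀))` uniformly in `t` and `L` (left to the reader; no `rpow` here).  Fixed cut-off; the Yang–Mills mass gap is NOT proved. [folklore] -/
theorem wilson_loop_transition_sub_transition_abs_le_coupling_uniform (L : ℕ) [NeZero L] (β₀ : ℝ) (hβ₀ : |β₀| < 1 / 12)
    {β₁ β₂ : ℝ} (hb₁ : β₁ ∈ Set.Icc (-|β₀|) |β₀|) (hb₂ : β₂ ∈ Set.Icc (-|β₀|) |β₀|)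
    (κ₁ : ℝ≥0 → Kernel (GaugeConfig 3 L (Matrix.specialUnitaryGroup (Fin 2) ℂ))
      (GaugeConfig 3 L (Matrix.specialUnitaryGroup (Fin 2) ℂ))) [∀ t, IsMarkovKernel (κ₁ t)]
    (hreal₁ : ∀ (t : ℝ≥0) (x : GaugeConfig 3 L (Matrix.specialUnitaryGroup (Fin 2) ℂ))
        (Ω : Type) [MeasurableSpace Ω] (P : Measure Ω) [IsProbabilityMeasure P]
        (W : ℝ≥0 → Ω → (Edge 3 L × NoiseIdx 2 → ℝ)) (hW : IsFlatBrownian W P)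
        (U : ℝ≥0 → Ω → GaugeConfig 3 L (Matrix.specialUnitaryGroup (Fin 2) ℂ)),
        (∀ ω, U 0 ω = x) →
        (latticeLangevinDynamics (fundamentalLatticeRep 2) β₁).IsSolution (fundamentalRep (Fin 2))
          hW.natFiltration P W U →
        κ₁ t x = P.map (U t))
    (κ₂ : ℝ≥0 → Kernel (GaugeConfig 3 L (Matrix.specialUnitaryGroup (Fin 2) ℂ))
      (GaugeConfig 3 L (Matrix.specialUnitaryGroup (Fin 2) ℂ))) [∀ t, IsMarkovKernel (κ₂ t)]
    (hreal₂ : ∀ (t : ℝ≥0) (x : GaugeConfig 3 L (Matrix.specialUnitaryGroup (Fin 2) ℂ))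
        (Ω : Type) [MeasurableSpace Ω] (P : Measure Ω) [IsProbabilityMeasure P]
        (W : ℝ≥0 → Ω → (Edge 3 L × NoiseIdx 2 → ℝ)) (hW : IsFlatBrownian W P)
        (U : ℝ≥0 → Ω → GaugeConfig 3 L (Matrix.specialUnitaryGroup (Fin 2) ℂ)),
        (∀ ω, U 0 ω = x) →
        (latticeLangevinDynamics (fundamentalLatticeRep 2) β₂).IsSolution (fundamentalRep (Fin 2))
          hW.natFiltration P W U →
        κ₂ t x = P.map (U t))
    (l₁ : List (Edge 3 L × Bool)) (hl₁ : l₁ ≠ []) (t : ℝ≥0) (x : (GaugeConfig 3 L (Matrix.specialUnitaryGroup (Fin 2) ℂ))) (τ : ℝ) (hτ : 0 ≤ τ) :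
    let coords : GaugeConfig 3 L (Matrix.specialUnitaryGroup (Fin 2) ℂ) → (Edge 3 L × Fin 2 × Fin 2 × Bool → ℝ) :=
      fun V q => (fun z : ℂ => if q.2.2.2 then z.im else z.re)
        ((fundamentalRep (Fin 2) (V q.1) : Matrix (Fin 2) (Fin 2) ℂ) q.2.1 q.2.2.1)
    |(∫ y, (fun y : (Edge 3 L × Fin 2 × Fin 2 × Bool → ℝ) => ((l₁.map (fun a : Edge 3 L × Bool => if a.2 then ((fun (ee : Edge 3 L) => Matrix.of fun (i j : Fin 2) => ((y (ee, i, j, false) : ℝ) : ℂ) + ((y (ee, i, j, true) : ℝ) : ℂ) * Complex.I) a.1)ᴴ else (fun (ee : Edge 3 L) => Matrix.of fun (i j : Fin 2) => ((y (ee, i, j, false) : ℝ) : ℂ) + ((y (ee, i, j, true) : ℝ) : ℂ) * Complex.I) a.1)).prod).trace.re) (coords y) ∂(κ₁ t x)) - ∫ y, (fun y : (Edge 3 L × Fin 2 × Fin 2 × Bool → ℝ) => ((l₁.map (fun a : Edge 3 L × Bool => if a.2 then ((fun (ee : Edge 3 L) => Matrix.of fun (i j : Fin 2) => ((y (ee,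 i, j, false) : ℝ) : ℂ) + ((y (ee, i, j, true) : ℝ) : ℂ) * Complex.I) a.1)ᴴ else (fun (ee : Edge 3 L) => Matrix.of fun (i j : Fin 2) => ((y (ee, i, j, false) : ℝ) : ℂ) + ((y (ee, i, j, true) : ℝ) : ℂ) * Complex.I) a.1)).prod).trace.re) (coords y) ∂(κ₂ t x)| ≤
      13824 * Real.pi * |β₁ - β₂| * τ * Real.exp (((1300 + 4 * Real.sqrt 2) * |β₀|) * τ) * (2 * Real.pi * (l₁.length : ℝ) ^ 2) + 24 * Real.sqrt 2 * Real.pi * (l₁.length : ℝ) ^ 2 * (27 * (1 + 6 * (((1300 + 4 * Real.sqrt 2) * |β₀|) + (1 - 12 * |β₀|)) / (1 - 12 * |β₀|)) ^ 3 + 2) * Real.exp (-((1 - 12 * |β₀|) * τ / 2)) + (3 * (l₁.length : ℝ) * ((1024 * Real.pi ^ 2 * (l₁.length : ℝ) ^ 2) / (1 - 12 * |β₀|) * Real.exp (Real.log 108 / 2) * ((1 + 12 / ((1 - 12 * |β₀|) * Real.log 108 / (2 * ((1300 + 4 * Real.sqrt 2) * |β₀| + (1 - 12 * |β₀|)))))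 ^ 3 / (1 - Real.exp (-(((1 - 12 * |β₀|) * Real.log 108 / (2 * ((1300 + 4 * Real.sqrt 2) * |β₀| + (1 - 12 * |β₀|)))) / 2)))))) * |β₁ - β₂| := by
  intro coords
  classical
  have hβ₁ : |β₁| ≤ |β₀| := abs_le.2 ⟨hb₁.1, hb₁.2⟩
  have hβ₂ : |β₂| ≤ |β₀| := abs_le.2 ⟨hb₂.1, hb₂.2⟩
  have hβ₁' : |β₁| < 1 / 12 := lt_of_le_of_lt hβ₁ hβ₀
  have hβ₂' : |β₂| < 1 / 12 := lt_of_le_of_lt hβ₂ hβ₀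
  set n₁ : ℝ := (l₁.length : ℝ) with hn₁
  have hn₁0 : 0 ≤ n₁ := by positivity
  -- the word data
  set ℓF : Edge 3 L → ℝ := fun e => if e ∈ (l₁.map Prod.fst).toFinset then 2 * Real.pi * n₁ else 0 with hℓF
  have hℓF0 : ∀ e, 0 ≤ ℓF e := fun e => by
    simp only [hℓF]; split_ifs
    · positivity
    · exact le_rfl
  have hLf := word_linkLipschitz_profile L β₁ l₁
  have hSF : (∑ e : Edge 3 L, ℓF e) ≤ 2 * Real.pi * n₁ ^ 2 := sum_word_profile_le (L := L) l₁
  have hSF0 : 0 ≤ ∑ e : Edge 3 L, ℓF e := Finset.sum_nonneg fun e _ => hℓF0 e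
  -- the three inputs
  have hLC := transition_sub_transition_abs_le_coupling L β₁ β₂ κ₁ hreal₁ κ₂ hreal₂ (contDiff_word (L := L) l₁ (m := 3)) hℓF0 t x
    (fun e y y' h => hLf e y y' h)
  have hM1 := wilson_word_pointwise_mixing_uniform L β₁ hβ₁' κ₁ hreal₁ l₁ t x
  have hM2 := wilson_word_pointwise_mixing_uniform L β₂ hβ₂' κ₂ hreal₂ l₁ t x
  have hST := wilson_loop_expectation_lipschitz L β₀ hβ₀ l₁ hl₁ hb₁ hb₂
  -- opaque names for the quantities
  obtain ⟨A1, hA1⟩ : ∃ A : ℝ, A = ∫ y, (fun y : (Edge 3 L × Fin 2 × Fin 2 × Bool → ℝ) => ((l₁.map (fun a : Edge 3 L × Bool => if a.2 then ((fun (ee : Edge 3 L) => Matrix.of fun (i j : Fin 2) => ((y (ee, i, j, false) : ℝ) : ℂ) + ((y (ee, i, j, true) : ℝ) : ℂ) * Complex.I) a.1)ᴴ else (fun (ee : Edge 3 L) => Matrix.of fun (i j : Fin 2) => ((y (ee, i, j, false) : ℝ) : ℂ) + ((y (ee, i, j, true) : ℝ) : ℂ) * Complex.I) a.1)).prod).trace.re)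 (coords y) ∂(κ₁ t x) := ⟨_, rfl⟩
  obtain ⟨A2, hA2⟩ : ∃ A : ℝ, A = ∫ y, (fun y : (Edge 3 L × Fin 2 × Fin 2 × Bool → ℝ) => ((l₁.map (fun a : Edge 3 L × Bool => if a.2 then ((fun (ee : Edge 3 L) => Matrix.of fun (i j : Fin 2) => ((y (ee, i, j, false) : ℝ) : ℂ) + ((y (ee, i, j, true) : ℝ) : ℂ) * Complex.I) a.1)ᴴ else (fun (ee : Edge 3 L) => Matrix.of fun (i j : Fin 2) => ((y (ee, i, j, false) : ℝ) : ℂ) + ((y (ee, i, j, true) : ℝ) : ℂ) * Complex.I) a.1)).prod).trace.re) (coords y) ∂(κ₂ t x) := ⟨_, rfl⟩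
  obtain ⟨E1, hE1⟩ : ∃ E : ℝ, E = ∫ y, (fun y : (Edge 3 L × Fin 2 × Fin 2 × Bool → ℝ) => ((l₁.map (fun a : Edge 3 L × Bool => if a.2 then ((fun (ee : Edge 3 L) => Matrix.of fun (i j : Fin 2) => ((y (ee, i, j, false) : ℝ) : ℂ) + ((y (ee, i, j, true) : ℝ) : ℂ) * Complex.I) a.1)ᴴ else (fun (ee : Edge 3 L) => Matrix.of fun (i j : Fin 2) => ((y (ee, i, j, false) : ℝ) : ℂ) + ((y (ee, i, j, true) : ℝ) : ℂ) * Complex.I) a.1)).prod).trace.re) (coords y) ∂(wilsonMeasure (d := 3) (L := L) (fundamentalRep (Fin 2)) β₁) := ⟨_, rfl⟩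
  obtain ⟨E2, hE2⟩ : ∃ E : ℝ, E = ∫ y, (fun y : (Edge 3 L × Fin 2 × Fin 2 × Bool → ℝ) => ((l₁.map (fun a : Edge 3 L × Bool => if a.2 then ((fun (ee : Edge 3 L) => Matrix.of fun (i j : Fin 2) => ((y (ee, i, j, false) : ℝ) : ℂ) + ((y (ee, i, j, true) : ℝ) : ℂ) * Complex.I) a.1)ᴴ else (fun (ee : Edge 3 L) => Matrix.of fun (i j : Fin 2) => ((y (ee, i, j, false) : ℝ) : ℂ) + ((y (ee, i, j, true) : ℝ) : ℂ) * Complex.I) a.1)).prod).trace.re) (coords y) ∂(wilsonMeasure (d := 3) (L := L) (fundamentalRep (Fin 2)) β₂) := ⟨_, rfl⟩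
  obtain ⟨Cst, hCst⟩ : ∃ C : ℝ, C = (3 * (l₁.length : ℝ) * ((1024 * Real.pi ^ 2 * (l₁.length : ℝ) ^ 2) / (1 - 12 * |β₀|) * Real.exp (Real.log 108 / 2) * ((1 + 12 / ((1 - 12 * |β₀|) * Real.log 108 / (2 * ((1300 + 4 * Real.sqrt 2) * |β₀| + (1 - 12 * |β₀|))))) ^ 3 / (1 - Real.exp (-(((1 - 12 * |β₀|) * Real.log 108 / (2 * ((1300 + 4 * Real.sqrt 2) * |β₀| + (1 - 12 * |β₀|)))) / 2)))))) := ⟨_, rfl⟩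
  have hLC' : |A1 - A2| ≤ 13824 * Real.pi * |β₁ - β₂| * (t : ℝ) * Real.exp (|β₂| * (4 + 4 * Real.sqrt 2 + 12 * 108) * (t : ℝ)) * (∑ e : Edge 3 L, ℓF e) := by
    rw [hA1, hA2]; exact hLC
  have hM1' : |A1 - E1| ≤ 12 * Real.sqrt 2 * Real.pi * (l₁.length : ℝ) ^ 2 * ((3 * (((1300 + 4 * Real.sqrt 2) * |β₁| + (1 - 12 * |β₁|)) * (t : ℝ)) + 1) ^ 3 + 2) * Real.exp (-((1 - 12 * |β₁|) * (t : ℝ))) := by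
    rw [hA1, hE1]; exact hM1
  have hM2' : |A2 - E2| ≤ 12 * Real.sqrt 2 * Real.pi * (l₁.length : ℝ) ^ 2 * ((3 * (((1300 + 4 * Real.sqrt 2) * |β₂| + (1 - 12 * |β₂|)) * (t : ℝ)) + 1) ^ 3 + 2) * Real.exp (-((1 - 12 * |β₂|) * (t : ℝ))) := by
    rw [hA2, hE2]; exact hM2
  have hSTc : |E2 - E1| ≤ Cst * |β₂ - β₁| := by rw [hE1, hE2, hCst]; exact hST
  clear hLC hM1 hM2 hST
  rw [← hA1, ← hA2, ← hCst]
  -- monotonicity of the rates in the coupling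
  set lam0 : ℝ := ((1300 + 4 * Real.sqrt 2) * |β₀|) with hlam0
  set rho0 : ℝ := (1 - 12 * |β₀|) with hrho0
  have hlam00 : 0 ≤ lam0 := by rw [hlam0]; positivity
  have hrho00 : 0 < rho0 := by rw [hrho0]; linarith only [hβ₀]
  have hs1 := mul_le_mul_of_nonneg_left hβ₁ (Real.sqrt_nonneg 2)
  have hs2 := mul_le_mul_of_nonneg_left hβ₂ (Real.sqrt_nonneg 2)
  have hp1 := mul_nonneg (Real.sqrt_nonneg 2) (abs_nonneg β₁)
  have hp2 := mul_nonneg (Real.sqrt_nonneg 2) (abs_nonneg β₂)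
  have hlam2 : |β₂| * (4 + 4 * Real.sqrt 2 + 12 * 108) ≤ lam0 := by
    rw [hlam0]; linarith only [hs2, hβ₂]
  have hsum₁ : (1300 + 4 * Real.sqrt 2) * |β₁| + (1 - 12 * |β₁|) ≤ lam0 + rho0 := by
    rw [hlam0, hrho0]; linarith only [hs1, hβ₁]
  have hsum₂ : (1300 + 4 * Real.sqrt 2) * |β₂| + (1 - 12 * |β₂|) ≤ lam0 + rho0 := by
    rw [hlam0, hrho0]; linarith only [hs2, hβ₂]
  have hsum₁0 : 0 ≤ (1300 + 4 * Real.sqrt 2) * |β₁| + (1 - 12 * |β₁|) := by linarith only [hp1, abs_nonneg β₁, hβ₁']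
  have hsum₂0 : 0 ≤ (1300 + 4 * Real.sqrt 2) * |β₂| + (1 - 12 * |β₂|) := by linarith only [hp2, abs_nonneg β₂, hβ₂']
  have hrho1 : rho0 ≤ 1 - 12 * |β₁| := by rw [hrho0]; linarith only [hβ₁]
  have hrho2 : rho0 ≤ 1 - 12 * |β₂| := by rw [hrho0]; linarith only [hβ₂]
  set K3 : ℝ := 27 * (1 + 6 * (lam0 + rho0) / rho0) ^ 3 + 2 with hK3
  have hK30 : 0 ≤ K3 := by rw [hK3]; positivity
  have hST0 : 0 ≤ Cst * |β₁ - β₂| := by rw [abs_sub_comm]; exact (abs_nonneg _).trans hSTc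
  have hP2 : 0 ≤ 24 * Real.sqrt 2 * Real.pi * n₁ ^ 2 * K3 * Real.exp (-(rho0 * τ / 2)) := by positivity
  have hP1 : 0 ≤ 13824 * Real.pi * |β₁ - β₂| * τ * Real.exp (lam0 * τ) * (2 * Real.pi * n₁ ^ 2) := by positivity
  rcases le_total (t : ℝ) τ with hle | hge
  · -- before the crossover: the coupling light cone
    have h1 : Real.exp (|β₂| * (4 + 4 * Real.sqrt 2 + 12 * 108) * (t : ℝ)) ≤ Real.exp (lam0 * τ) :=
      Real.exp_le_exp.2 (mul_le_mul hlam2 hle t.coe_nonneg hlam00)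
    have h2 : 13824 * Real.pi * |β₁ - β₂| * (t : ℝ) * Real.exp (|β₂| * (4 + 4 * Real.sqrt 2 + 12 * 108) * (t : ℝ)) * (∑ e : Edge 3 L, ℓF e) ≤
        13824 * Real.pi * |β₁ - β₂| * τ * Real.exp (lam0 * τ) * (2 * Real.pi * n₁ ^ 2) := by
      have hpre : 0 ≤ 13824 * Real.pi * |β₁ - β₂| := by positivity
      calc 13824 * Real.pi * |β₁ - β₂| * (t : ℝ) * Real.exp (|β₂| * (4 + 4 * Real.sqrt 2 + 12 * 108) * (t : ℝ)) * (∑ e : Edge 3 L, ℓF e)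
          = 13824 * Real.pi * |β₁ - β₂| * ((t : ℝ) * Real.exp (|β₂| * (4 + 4 * Real.sqrt 2 + 12 * 108) * (t : ℝ)) * (∑ e : Edge 3 L, ℓF e)) := by ring
        _ ≤ 13824 * Real.pi * |β₁ - β₂| * (τ * Real.exp (lam0 * τ) * (2 * Real.pi * n₁ ^ 2)) :=
            mul_le_mul_of_nonneg_left (mul_le_mul (mul_le_mul hle h1 (Real.exp_nonneg _) hτ) hSF hSF0 (by positivity)) hpre
        _ = _ := by ring
    linarith only [hLC', h2, hP2, hST0]
  · -- after the crossover: mixing of both dynamics + static Lipschitz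
    have hcube := cube_add_two_mul_exp_neg_le (c := 3 * (lam0 + rho0)) (ρ := rho0) (t := (t : ℝ)) (by positivity) hrho00 t.coe_nonneg
    have eK : (27 * (1 + 2 * (3 * (lam0 + rho0)) / rho0) ^ 3 + 2) = K3 := by rw [hK3]; ring
    rw [eK] at hcube
    have hexpτ : Real.exp (-(rho0 * (t : ℝ) / 2)) ≤ Real.exp (-(rho0 * τ / 2)) := by
      have hm := mul_le_mul_of_nonneg_left hge hrho00.le
      rw [Real.exp_le_exp]; linarith only [hm]
    -- the transient of each dynamics is below the `β₀`-transient
    have htr : ∀ (lamr rhor : ℝ), 0 ≤ lamr → lamr ≤ lam0 + rho0 → rho0 ≤ rhor →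
        ((3 * (lamr * (t : ℝ)) + 1) ^ 3 + 2) * Real.exp (-(rhor * (t : ℝ))) ≤ K3 * Real.exp (-(rho0 * τ / 2)) := by
      intro lamr rhor hl0 hl hr
      have hm1 := mul_le_mul_of_nonneg_right hl t.coe_nonneg
      have hm2 := mul_le_mul_of_nonneg_right hr t.coe_nonneg
      have a1 : (3 * (lamr * (t : ℝ)) + 1) ^ 3 ≤ (3 * (lam0 + rho0) * (t : ℝ) + 1) ^ 3 :=
        pow_le_pow_left₀ (by positivity) (by linarith only [hm1]) 3
      have a2 : Real.exp (-(rhor * (t : ℝ))) ≤ Real.exp (-(rho0 * (t : ℝ))) := Real.exp_le_exp.2 (by linarith only [hm2])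
      calc ((3 * (lamr * (t : ℝ)) + 1) ^ 3 + 2) * Real.exp (-(rhor * (t : ℝ)))
          ≤ ((3 * (lam0 + rho0) * (t : ℝ) + 1) ^ 3 + 2) * Real.exp (-(rho0 * (t : ℝ))) :=
            mul_le_mul (by linarith only [a1]) a2 (Real.exp_nonneg _) (by positivity)
        _ ≤ K3 * Real.exp (-(rho0 * (t : ℝ) / 2)) := hcube
        _ ≤ K3 * Real.exp (-(rho0 * τ / 2)) := mul_le_mul_of_nonneg_left hexpτ hK30
    have hm1 := htr _ _ hsum₁0 hsum₁ hrho1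
    have hm2 := htr _ _ hsum₂0 hsum₂ hrho2
    have hpre : 0 ≤ 12 * Real.sqrt 2 * Real.pi * n₁ ^ 2 := by positivity
    have hM1'' : |A1 - E1| ≤ 12 * Real.sqrt 2 * Real.pi * n₁ ^ 2 * (K3 * Real.exp (-(rho0 * τ / 2))) := by
      refine hM1'.trans ?_
      rw [mul_assoc (12 * Real.sqrt 2 * Real.pi * n₁ ^ 2)]
      exact mul_le_mul_of_nonneg_left hm1 hpre
    have hM2'' : |A2 - E2| ≤ 12 * Real.sqrt 2 * Real.pi * n₁ ^ 2 * (K3 * Real.exp (-(rho0 * τ / 2))) := by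
      refine hM2'.trans ?_
      rw [mul_assoc (12 * Real.sqrt 2 * Real.pi * n₁ ^ 2)]
      exact mul_le_mul_of_nonneg_left hm2 hpre
    have hST' : |E1 - E2| ≤ Cst * |β₁ - β₂| := by rw [abs_sub_comm E1, abs_sub_comm β₁]; exact hSTc
    have htri : |A1 - A2| ≤ |A1 - E1| + |E1 - E2| + |A2 - E2| := by
      calc |A1 - A2| = |(A1 - E1) + (E1 - E2) - (A2 - E2)| := by ring_nf
        _ ≤ |(A1 - E1) + (E1 - E2)| + |A2 - E2| := abs_sub _ _
        _ ≤ |A1 - E1| + |E1 - E2| + |A2 - E2| := by linarith [abs_add_le (A1 - E1) (E1 - E2)]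
    -- opaque atoms, then linear arithmetic
    obtain ⟨Q, hQ⟩ : ∃ Q : ℝ, Q = K3 * Real.exp (-(rho0 * τ / 2)) := ⟨_, rfl⟩
    rw [← hQ] at hM1'' hM2''
    have eP2 : 24 * Real.sqrt 2 * Real.pi * n₁ ^ 2 * K3 * Real.exp (-(rho0 * τ / 2)) = 2 * (12 * Real.sqrt 2 * Real.pi * n₁ ^ 2 * Q) := by
      rw [hQ]; ring
    rw [eP2]
    clear hM1' hM2' hSTc hLC' hcube htr hm1 hm2 hexpτ eK hQ eP2
    linarith only [htri, hM1'', hM2'', hST', hP1]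

end Summit.QuantumFields.YangMills.Theorems.ColdStartUniversality.LiebRobinson

end
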